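import Summits.NavierStokesRegularity.NavierStokesRegularity.Theses.SqueezeCycle
import Summits.NavierStokesRegularity.NavierStokesRegularity.Theorems.RecurrentProfilesRecurrentReduction
import Summits.NavierStokesRegularity.NavierStokesRegularity.Theorems.RellichScarTypeIBlowupProfile

/-!
# `RecurrentLiouville` (crux stmt-NavierStokesRegularity-1589): the recurrence hypothesis is NOT
# load-bearing — kill criterion of the crux (negative-side support, cdisprove, gen 1)

Importable lemma of the standing disprover of the crux `SqueezeCycle.RecurrentLiouville`
(= `RecurrentProfiles.RecurrentLiouville` letter for letter, `recurrentLiouville_routes_agree`;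
item stmt-NavierStokesRegularity-1589, shared by routes RecurrentProfiles and SqueezeCycle).

The crux asks a Liouville theorem only for UNIFORMLY RECURRENT Type-I profiles of the
Albritton–Barker class. Because the reduction to recurrent profiles is PROVED in tree
(`Theorems.recurrentReduction_proof` = item stmt-NavierStokesRegularity-1590: an origin-singular
class profile yields a uniformly recurrent origin-singular class profile with the same rate
constant — Birkhoff minimal sets inside the compact invariant set of singular profiles), the
recurrence hypothesis can be dropped at no cost:

* the crux with the recurrence clause DROPPED is, letter for letter, the route target
  `RecurrentProfiles.NoTypeIRateProfile` (item stmt-NavierStokesRegularity-1588) — no new name is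
  introduced for it, the theorems below are stated about that decl;
* `noTypeIRateProfile_false_iff` — `¬ (crux without recurrence) ↔ ¬ crux`: the two statements
  have the same counterexamples, i.e. recurrence is a free normalisation ("WLOG the profile is
  uniformly recurrent"), not a restriction of the problem — no `_false_without_recurrence`
  witness can exist unless the crux itself is false;
* `recurrentLiouville_false_iff_typeISingularProfileExists` — KILL CRITERION: the crux is false
  iff SOME suitable weak solution on the slab with weak gradient, `𝐈 < ⊤` and the Type-I rate is
  backward-singular at the origin (recurrent or not). A refuter therefore needs ANY Type-I
  singularity model of the local-energy class — a backward `λ`-DSS / RDSS profile with the rate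
  (Bradshaw–Tsai Open Problem 5.1, Tsai's conjecture; open), an `α ≈ 1` rotated self-similar
  profile (Pineau–Vicol 2026, Conj. 1.1 middle range), or any non-recurrent one — and a prover
  gains from recurrence only what the minimal-set structure gives, never smallness or a sign;
* `typeISingularProfileExists_of_typeIBlowup` — WIDER, physical form of the kill criterion: by
  the PROVED `typeIBlowupProfile_proof` (item 1591, Albritton–Barker 2019 §3 zoom) any
  finite-energy classical solution from a rapidly decaying datum whose maximal time is a Type-I-rate
  blow-up produces a Type-I singularity model, hence (read through the iff above) refutes the crux: a certified Type-I blow-up computation from Schwartz-class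
  data would kill it (none exists; axisymmetric candidates are Type II by Seregin–Šverák 2009).

## References

* D. Albritton, T. Barker, *On local Type I singularities of the Navier–Stokes equations and
  Liouville theorems*, J. Math. Fluid Mech. 21 (2019), Thm. 1.1, Lemma 2.2, Prop. 2.3.
  [AlbrittonBarker2019]
* H. Furstenberg, *Recurrence in Ergodic Theory and Combinatorial Number Theory* (1981), Thms.
  1.15–1.17 (minimal sets, uniform recurrence). [Furstenberg1981]
* Z. Bradshaw, T.-P. Tsai, CPDE 42 (2017), Open Problem 5.1. [BradshawTsai2017CPDE]
-/

noncomputable section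

open MeasureTheory TopologicalSpace Set Function Filter Topology Metric
open scoped InnerProductSpace RealInnerProductSpace ENNReal NNReal
open Literature.Analysis.FluidPDE
open Summit.NavierStokesRegularity.NavierStokesRegularity.Theses

set_option linter.dupNamespace false

namespace Summit.NavierStokesRegularity.NavierStokesRegularity.Theorems.RecurrentLiouville.Negative

/-- Physical space. -/
local notation "ℝ³" => EuclideanSpace ℝ (Fin 3)

/-- The open backward slab `(-∞,0) × ℝ³` (time first), as in the route file. -/
local notation "𝕊" => Literature.Analysis.FluidPDE.slab (EuclideanSpace ℝ (Fin 3)) (Set.Iio (0 : ℝ)) isOpen_Iio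

/-- The two route copies of the crux agree letter for letter. -/
theorem recurrentLiouville_routes_agree :
    SqueezeCycle.RecurrentLiouville ↔ RecurrentProfiles.RecurrentLiouville :=
  Iff.rfl

/-- **A Type-I singularity model of the local-energy class**: the antecedent of the crux MINUS
the recurrence clause, together with a backward-singular origin (the blow-up profile of a
Type-I singularity in the sense of Albritton–Barker 2019, Thm. 1.1). A HYPOTHESIS-OBJECT naming
the would-be counterexample, not a fact: no such profile is known. -/
def TypeISingularProfileExists : Prop :=
  ∃ (u : ℝ → ℝ³ → ℝ³) (p : ℝ → ℝ³ → ℝ) (G : ℝ → ℝ³ → ℝ³ →L[ℝ] ℝ³) (C : ℝ),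
    IsSuitableWeakSolutionOn 𝕊 1 0 u p ∧ HasWeakSpatialGradientOn 𝕊 u G ∧
    typeIBound (Set.Iio (0 : ℝ) ×ˢ Set.univ) u p G < ⊤ ∧ HasTypeITimeDecay C u ∧
    IsBackwardSingularPoint u 0

/-- The crux WITH THE RECURRENCE CLAUSE DROPPED is letter for letter the route target
`RecurrentProfiles.NoTypeIRateProfile`; it fails exactly when a Type-I singularity model exists. -/
theorem noTypeIRateProfile_false_iff_typeISingularProfileExists :
    ¬ RecurrentProfiles.NoTypeIRateProfile ↔ TypeISingularProfileExists := by
  constructor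
  · intro h
    by_contra hne
    refine h fun u p G C hsw hwg hI hdec hsing => hne ⟨u, p, G, C, hsw, hwg, hI, hdec, hsing⟩
  · rintro ⟨u, p, G, C, hsw, hwg, hI, hdec, hsing⟩ h
    exact h u p G C hsw hwg hI hdec hsing

/-- **KILL CRITERION of the crux.** `RecurrentLiouville` is false iff some suitable weak solution
on the slab with weak gradient, `𝐈 < ⊤` and the Type-I rate is backward-singular at the origin —
recurrence plays no role in the set of counterexamples: (⇐) by the PROVED reduction
`recurrentReduction_proof` (item 1590) a Type-I singularity model yields a uniformly recurrent
singular class profile with the same rate constant, which the crux declares regular; (⇒) a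
counterexample to the crux is in particular a Type-I singularity model.
[cite: AlbrittonBarker2019, Thm. 1.1, Prop. 2.3] -/
theorem recurrentLiouville_false_iff_typeISingularProfileExists :
    ¬ SqueezeCycle.RecurrentLiouville ↔ TypeISingularProfileExists := by
  constructor
  · intro h
    by_contra hne
    refine h fun u p G C hsw hwg hI hdec _ hsing => hne ⟨u, p, G, C, hsw, hwg, hI, hdec, hsing⟩
  · rintro ⟨u, p, G, C, hsw, hwg, hI, hdec, hsing⟩ hL
    obtain ⟨w, q, H, hsw', hwg', hI', hdec', hsing', hrec'⟩ :=
      recurrentReduction_proof u p G C hsw hwg hI hdec hsing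
    exact hL w q H C hsw' hwg' hI' hdec' hrec' hsing'

/-- **The recurrence hypothesis is NOT load-bearing**: the crux and the crux-without-recurrence
(= `RecurrentProfiles.NoTypeIRateProfile`) have the same counterexamples (so no
`_false_without_recurrence` witness exists short of a refutation of the crux itself; recurrence
is a free normalisation bought by the proved reduction, not a restriction). -/
theorem noTypeIRateProfile_false_iff :
    ¬ RecurrentProfiles.NoTypeIRateProfile ↔ ¬ SqueezeCycle.RecurrentLiouville := by
  rw [noTypeIRateProfile_false_iff_typeISingularProfileExists,
    recurrentLiouville_false_iff_typeISingularProfileExists]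

/-- **A Type-I blow-up from rapidly decaying data** (the physical object): a finite-energy
classical solution on `[0,T)` from a rapidly decaying datum, maximal (no smooth extension past
`T`), blowing up at most at the Type-I rate. A HYPOTHESIS-OBJECT (the would-be physical
counterexample), not a fact: no such blow-up is known. -/
def TypeIBlowupExists : Prop :=
  ∃ (ν T : ℝ) (u : ℝ → ℝ³ → ℝ³) (p : ℝ → ℝ³ → ℝ), 0 < ν ∧ 0 < T ∧
    IsMaximalSmoothSolution ν 0 u p T ∧ IsLerayHopfOn T ν 0 (u 0) u ∧
    HasRapidSpatialDecay (u 0) ∧ IsTypeIBlowup u T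

/-- **Wider kill criterion (physical form).** A Type-I blow-up from rapidly decaying data yields
a Type-I singularity model of the Albritton–Barker class — the PROVED item `TypeIBlowupProfile`
(stmt-1591, `typeIBlowupProfile_recurrentProfiles`: Morrey bound, singular point at the maximal
time, viscosity-normalising zoom, Seregin's ancient limit, persistence). Composed with
`recurrentLiouville_false_iff_typeISingularProfileExists` it refutes the crux.
[cite: AlbrittonBarker2019, §3 and Remark 3.2] -/
theorem typeISingularProfileExists_of_typeIBlowup (h : TypeIBlowupExists) :
    TypeISingularProfileExists := by
  obtain ⟨ν, T, u, p, hν, hT, hmax, hLH, hdec, hI⟩ := h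
  obtain ⟨w, q, H, C, hsw, hwg, hIb, hrate, hsing⟩ :=
    typeIBlowupProfile_recurrentProfiles ν T hν hT u p hmax hLH hdec hI
  exact ⟨w, q, H, C, hsw, hwg, hIb, hrate, hsing⟩

end Summit.NavierStokesRegularity.NavierStokesRegularity.Theorems.RecurrentLiouville.Negative

end
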